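import Literature.Combinatorics.Optimization.PsdLiftSlackMatrix
import HarnessLib

/-!
# FGPRT Example 2.7: the psd rank of the `3 × 3` circulant `M(a,b,c)` — PROVED
# (Fawzi–Gouveia–Parrilo–Robinson–Thomas 2015)

Source: H. Fawzi, J. Gouveia, P. A. Parrilo, R. Z. Robinson, R. R. Thomas, *Positive semidefinite
rank*, Math. Program. Ser. B 153 (2015) 133–177 = arXiv:1407.4095 [FawziEtAl2015], Example 2.7 (held
text `paper:arxiv-1407.4095`, chunk p05; arXiv numbering). Vocabulary: the tree's
`HasPsdFactorization M k` ("`rank_psd M ≤ k`", `PatternMatrixPsdRank.lean`), `pairSlackMatrix`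
(`PsdLiftSlackMatrix.lean`, FGPRT Definition 3.1) and the PROVED §4 criterion
`FawziEtAl2015_sec4_ellipse_holds` ("`rank_psd S_{P,Q} = 2` iff an ellipse nests between the planar
polygons `P ⊆ Q`", FGPRT §4 p13 / Gouveia–Robinson–Thomas).

Example 2.7 (p05, verbatim): "Consider more generally the following `3×3` circulant matrix, where
`a,b,c` are nonnegative real numbers: `M(a,b,c) = [[a,b,c],[c,a,b],[b,c,a]]`. One can check that the
usual rank of `M(a,b,c)` is `3` unless `a=b=c` in which case the rank is one. When `rank(M(a,b,c)) = 3`,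
the bounds in (2) say that `2 ≤ rank_psd(M(a,b,c)) ≤ 3`. Using the geometric interpretation of the
psd rank (cf. Section 3) one can show that
`rank_psd(M(a,b,c)) ≤ 2 ⟺ a² + b² + c² ≤ 2(ab + bc + ac)`."

Contents, all PROVED:
* `circulant3 a b c` and `det_circulant3` (`det = (a+b+c)(a²+b²+c²−ab−bc−ca)`), the rank sentence:
  `rank_circulant3_eq_three` (nonnegative, not all equal ⇒ rank `3`) and `rank_circulant3_self_le_one`
  (`rank M(a,a,a) ≤ 1`); the bounds sentence `FawziEtAl2015_ex27_bounds` (rank `3` ⇒ no psd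
  factorization of size `1`, and one of size `3`).
* The geometric interpretation made explicit and RATIONAL (`ex27Vertex`, `ex27Normal`,
  `circulant3_eq_pairSlackMatrix`): with `p = (a+b+c)/3`, `M(a,b,c)` is the slack matrix of the
  triangle `P = conv{(p−a, c−p), (p−c, b−p), (p−b, a−p)}` inside the triangle
  `Q = {y : y₁ ≤ p, −y₁ + y₂ ≤ p, −y₂ ≤ p}`; both are invariant under the order-three integer matrix
  `R = [[0,−1],[1,−1]]` (so no `√3` appears), whose invariant quadratic form is `G(y) = 2y₁² − 2y₁y₂ + 2y₂²`.
* **The equivalence** `FawziEtAl2015_ex27` (for ALL nonnegative `a, b, c`; the case `a = b = c` being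
  trivial): `HasPsdFactorization (circulant3 a b c) 2 ↔ a² + b² + c² ≤ 2(ab + bc + ac)`.
  "⇐": the `G`-disc `{G(y) ≤ 3p²/2}` is an ellipse between `P` and `Q`; "⇒": by the §4 criterion some
  ellipse `E = {q ≤ 0}` nests between `P` and `Q`; summing `q` over the `R`-orbit kills the linear term
  (`I + R + R² = 0`) and turns the quadratic part into `(A₁₁ + A₁₂ + A₂₂)·G` (`sum_quad_orbit`), so the
  point `y* = (t, t/2)` with `G(y*) = G(x₀)` has `Σ_m q(R^m y*) = Σ_i q(x_i) ≤ 0`; hence some `R^m y*`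
  lies in `E ⊆ Q`, giving `t ≤ p`, i.e. `G(x₀) ≤ 3p²/2`, which is the inequality.

No new definitions of notions beyond the explicit matrices/points, no named facts.
-/

noncomputable section

open Matrix Finset
open scoped MatrixOrder

namespace Literature.Combinatorics.Optimization

/-! ### The matrix, its determinant and rank -/

/-- The `3 × 3` circulant `M(a,b,c) = [[a,b,c],[c,a,b],[b,c,a]]`. [cite: FawziEtAl2015, Ex. 2.7 (p05)] -/
def circulant3 (a b c : ℝ) : Matrix (Fin 3) (Fin 3) ℝ := !![a, b, c; c, a, b; b, c, a]

/-- `det M(a,b,c) = a³ + b³ + c³ − 3abc = (a+b+c)(a²+b²+c²−ab−bc−ca)`. [cite: FawziEtAl2015, Ex. 2.7 (p05)] -/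
theorem det_circulant3 (a b c : ℝ) :
    (circulant3 a b c).det = (a + b + c) * (a ^ 2 + b ^ 2 + c ^ 2 - a * b - b * c - c * a) := by
  rw [circulant3, Matrix.det_fin_three]
  simp
  ring

/-- **Example 2.7, rank** (p05: "the usual rank of `M(a,b,c)` is `3` unless `a=b=c`"): for nonnegative
`a, b, c` not all equal, `rank M(a,b,c) = 3`. [cite: FawziEtAl2015, Ex. 2.7 (p05)] -/
theorem rank_circulant3_eq_three {a b c : ℝ} (ha : 0 ≤ a) (hb : 0 ≤ b) (hc : 0 ≤ c)
    (h : ¬ (a = b ∧ b = c)) : (circulant3 a b c).rank = 3 := by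
  have hdet : (circulant3 a b c).det ≠ 0 := by
    rw [det_circulant3]
    refine mul_ne_zero ?_ ?_
    · intro h0
      have : a = 0 ∧ b = 0 ∧ c = 0 := ⟨by linarith, by linarith, by linarith⟩
      exact h ⟨by rw [this.1, this.2.1], by rw [this.2.1, this.2.2]⟩
    · intro h0
      have hsq : (a - b) ^ 2 + (b - c) ^ 2 + (c - a) ^ 2 = 0 := by linear_combination 2 * h0
      have hab : a - b = 0 := by nlinarith [sq_nonneg (a - b), sq_nonneg (b - c), sq_nonneg (c - a)]
      have hbc : b - c = 0 := by nlinarith [sq_nonneg (a - b), sq_nonneg (b - c), sq_nonneg (c - a)]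
      exact h ⟨by linarith, by linarith⟩
  have hunit : IsUnit (circulant3 a b c) :=
    (Matrix.isUnit_iff_isUnit_det _).mpr (isUnit_iff_ne_zero.mpr hdet)
  simpa using Matrix.rank_of_isUnit _ hunit

/-- **Example 2.7, rank** (p05: "… in which case the rank is one"): `M(a,a,a) = a·𝟙𝟙ᵀ` has rank at most
`1` (exactly `1` for `a ≠ 0`, and `0` for the zero matrix). [cite: FawziEtAl2015, Ex. 2.7 (p05)] -/
theorem rank_circulant3_self_le_one (a : ℝ) : (circulant3 a a a).rank ≤ 1 := by
  have h : circulant3 a a a = Matrix.vecMulVec (fun _ => a) (fun _ => (1 : ℝ)) := by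
    ext i j
    fin_cases i <;> fin_cases j <;> simp [circulant3, Matrix.vecMulVec_apply]
  rw [h]
  exact Matrix.rank_vecMulVec_le _ _

/-- **Example 2.7, the bounds** (p05: "When `rank(M(a,b,c)) = 3`, the bounds in (2) say that
`2 ≤ rank_psd(M(a,b,c)) ≤ 3`"): no psd factorization of size `1` (`rank ≤ C(k+1,2)`), and one of size
`3` (nonnegative `3 × 3`). [cite: FawziEtAl2015, Ex. 2.7 (p05), Prop. 2.5 (p05)] -/
theorem FawziEtAl2015_ex27_bounds {a b c : ℝ} (ha : 0 ≤ a) (hb : 0 ≤ b) (hc : 0 ≤ c)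
    (hr : (circulant3 a b c).rank = 3) :
    ¬ HasPsdFactorization (circulant3 a b c) 1 ∧ HasPsdFactorization (circulant3 a b c) 3 := by
  refine ⟨fun h1 => ?_, ?_⟩
  · have := h1.rank_le_choose
    rw [hr] at this
    norm_num [Nat.choose] at this
  · have hnn : ∀ i j, 0 ≤ circulant3 a b c i j := by
      intro i j
      fin_cases i <;> fin_cases j <;> simp [circulant3, ha, hb, hc]
    simpa using HasPsdFactorization.of_entry_nonneg_card_cols hnn

/-! ### The nested triangles -/

/-- The vertices `x₀ = (p−a, c−p)`, `x₁ = (p−c, b−p)`, `x₂ = (p−b, a−p)` of the inner triangle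
(`x_{i+1} = R x_i` for `R = [[0,−1],[1,−1]]`), `p = (a+b+c)/3`. [cite: FawziEtAl2015, Ex. 2.7 (p05) with
§3.1 (p09–p10)] -/
def ex27Vertex (a b c : ℝ) : Fin 3 → (Fin 2 → ℝ) :=
  ![![(a + b + c) / 3 - a, c - (a + b + c) / 3], ![(a + b + c) / 3 - c, b - (a + b + c) / 3],
    ![(a + b + c) / 3 - b, a - (a + b + c) / 3]]

/-- The facet normals `n₀ = (1,0)`, `n₁ = (−1,1)`, `n₂ = (0,−1)` of the outer triangle
`Q = {y : n_jᵀ y ≤ p}` (`n_j = n₀ R^{−j}`). [cite: FawziEtAl2015, Ex. 2.7 (p05) with §3.1 (p09–p10)] -/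
def ex27Normal : Fin 3 → (Fin 2 → ℝ) := ![![1, 0], ![-1, 1], ![0, -1]]

/-- **The geometric interpretation of `M(a,b,c)`**: `M(a,b,c)` is the slack matrix of the triangle
`conv{x_i}` with respect to the triangle `Q = {y : n_jᵀy ≤ p}`: `M(a,b,c)_{ij} = p − n_jᵀ x_i`.
[cite: FawziEtAl2015, Ex. 2.7 (p05), Def. 3.1 (p09)] -/
theorem circulant3_eq_pairSlackMatrix (a b c : ℝ) :
    (circulant3 a b c : Fin 3 → Fin 3 → ℝ) =
      pairSlackMatrix (ex27Vertex a b c) ex27Normal (fun _ => (a + b + c) / 3) := by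
  ext i j
  fin_cases i <;> fin_cases j <;>
    simp [circulant3, pairSlackMatrix, ex27Vertex, ex27Normal, dotProduct, Fin.sum_univ_two] <;> ring

/-- The inner triangle lies in `Q` iff `a, b, c ≥ 0` (the slacks are the entries of `M`).
[cite: FawziEtAl2015, Ex. 2.7 (p05)] -/
theorem ex27Vertex_mem {a b c : ℝ} (ha : 0 ≤ a) (hb : 0 ≤ b) (hc : 0 ≤ c) (i j : Fin 3) :
    ex27Normal j ⬝ᵥ ex27Vertex a b c i ≤ (a + b + c) / 3 := by
  have h := congrFun (congrFun (circulant3_eq_pairSlackMatrix a b c) i) j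
  simp only [pairSlackMatrix] at h
  have hnn : 0 ≤ circulant3 a b c i j := by
    fin_cases i <;> fin_cases j <;> simp [circulant3, ha, hb, hc]
  linarith

/-- The outer triangle `Q = {y : y₁ ≤ p, −y₁ + y₂ ≤ p, −y₂ ≤ p}` is bounded (§4 works with "two
polytopes in the plane", p13: "one can always choose the outer polyhedron `Q` to be bounded").
[cite: FawziEtAl2015, §4 (p13)] -/
theorem isBounded_ex27Q (p : ℝ) :
    Bornology.IsBounded {y : Fin 2 → ℝ | ∀ j, ex27Normal j ⬝ᵥ y ≤ p} := by
  rw [isBounded_iff_forall_norm_le]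
  refine ⟨2 * |p|, fun y hy => ?_⟩
  have h0 := hy 0
  have h1 := hy 1
  have h2 := hy 2
  simp [ex27Normal, dotProduct, Fin.sum_univ_two] at h0 h1 h2
  have hp : p ≤ |p| := le_abs_self p
  rw [pi_norm_le_iff_of_nonneg (by positivity)]
  intro i
  rw [Real.norm_eq_abs, abs_le]
  fin_cases i
  · exact ⟨by simp; linarith, by simp; linarith⟩
  · exact ⟨by simp; linarith, by simp; linarith⟩

/-! ### The invariant quadratic form and the orbit sum -/

/-- The general planar quadratic `q(y) = yᵀAy + 2cᵀy + γ` in coordinates. [folklore] -/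
private theorem quad_expand (A : Matrix (Fin 2) (Fin 2) ℝ) (c : Fin 2 → ℝ) (γ : ℝ) (y : Fin 2 → ℝ) :
    y ⬝ᵥ (A *ᵥ y) + 2 * (c ⬝ᵥ y) + γ =
      A 0 0 * y 0 ^ 2 + (A 0 1 + A 1 0) * y 0 * y 1 + A 1 1 * y 1 ^ 2 +
        2 * (c 0 * y 0 + c 1 * y 1) + γ := by
  simp [dotProduct, Matrix.mulVec, Fin.sum_univ_two]
  ring

/-- **The orbit sum**: for `R = [[0,−1],[1,−1]]` (`Ry = (−y₂, y₁−y₂)`, `R²y = (y₂−y₁, −y₁)`,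
`I + R + R² = 0`), `q(y) + q(Ry) + q(R²y) = (A₁₁ + ½(A₁₂+A₂₁) + A₂₂)·(2y₁² − 2y₁y₂ + 2y₂²) + 3γ`: the
linear term cancels and the quadratic term becomes a multiple of the `R`-invariant form `G`.
[cite: FawziEtAl2015, Ex. 2.7 (p05) ("Using the geometric interpretation … one can show")] -/
theorem sum_quad_orbit (A : Matrix (Fin 2) (Fin 2) ℝ) (c : Fin 2 → ℝ) (γ : ℝ) (y : Fin 2 → ℝ) :
    (y ⬝ᵥ (A *ᵥ y) + 2 * (c ⬝ᵥ y) + γ) +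
      (![-y 1, y 0 - y 1] ⬝ᵥ (A *ᵥ ![-y 1, y 0 - y 1]) + 2 * (c ⬝ᵥ ![-y 1, y 0 - y 1]) + γ) +
      (![y 1 - y 0, -y 0] ⬝ᵥ (A *ᵥ ![y 1 - y 0, -y 0]) + 2 * (c ⬝ᵥ ![y 1 - y 0, -y 0]) + γ) =
    (A 0 0 + (A 0 1 + A 1 0) / 2 + A 1 1) * (2 * y 0 ^ 2 - 2 * y 0 * y 1 + 2 * y 1 ^ 2) + 3 * γ := by
  rw [quad_expand, quad_expand, quad_expand]
  simp
  ring

/-! ### The equivalence -/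

/-- "⇐": if `a² + b² + c² ≤ 2(ab+bc+ca)` then the `G`-disc `{2y₁² − 2y₁y₂ + 2y₂² ≤ 3p²/2}` is an
ellipse nested between the two triangles. [cite: FawziEtAl2015, Ex. 2.7 (p05)] -/
theorem FawziEtAl2015_ex27_ellipse {a b c : ℝ} (ha : 0 ≤ a) (hb : 0 ≤ b) (hc : 0 ≤ c)
    (h : a ^ 2 + b ^ 2 + c ^ 2 ≤ 2 * (a * b + b * c + a * c)) :
    ∃ (A : Matrix (Fin 2) (Fin 2) ℝ) (cc : Fin 2 → ℝ) (γ : ℝ), A.PosDef ∧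
      (∀ i, ex27Vertex a b c i ⬝ᵥ (A *ᵥ ex27Vertex a b c i) + 2 * (cc ⬝ᵥ ex27Vertex a b c i) + γ ≤ 0) ∧
      ∀ y : Fin 2 → ℝ, y ⬝ᵥ (A *ᵥ y) + 2 * (cc ⬝ᵥ y) + γ ≤ 0 →
        ∀ j, ex27Normal j ⬝ᵥ y ≤ (a + b + c) / 3 := by
  set p : ℝ := (a + b + c) / 3 with hp
  have hp0 : 0 ≤ p := by rw [hp]; positivity
  refine ⟨!![2, -1; -1, 2], 0, -(3 / 2 * p ^ 2), ?_, fun i => ?_, fun y hy j => ?_⟩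
  · refine PosDef.of_dotProduct_mulVec_pos ?_ fun x hx => ?_
    · rw [Matrix.IsHermitian, Matrix.conjTranspose_eq_transpose_of_trivial]
      exact Matrix.IsSymm.ext fun i j => by fin_cases i <;> fin_cases j <;> rfl
    · have hq : star x ⬝ᵥ (!![2, -1; -1, 2] *ᵥ x) = x 0 ^ 2 + x 1 ^ 2 + (x 0 - x 1) ^ 2 := by
        simp [dotProduct, Matrix.mulVec, Fin.sum_univ_two]
        ring
      rw [hq]
      have hx' : x 0 ≠ 0 ∨ x 1 ≠ 0 := by
        by_contra hcon
        simp only [not_or, not_not] at hcon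
        exact hx (funext fun i => by fin_cases i <;> simp [hcon.1, hcon.2])
      rcases hx' with h0 | h1
      · have := sq_pos_of_ne_zero h0; positivity
      · have := sq_pos_of_ne_zero h1; positivity
  · rw [quad_expand]
    fin_cases i <;> simp [ex27Vertex] <;> nlinarith [h]
  · rw [quad_expand] at hy
    simp at hy
    -- `2y₁² − 2y₁y₂ + 2y₂² ≤ 3p²/2` forces each facet functional `≤ p`
    fin_cases j <;> simp [ex27Normal, dotProduct, Fin.sum_univ_two]
    · nlinarith [sq_nonneg (y 0 - 2 * y 1), sq_nonneg (y 0 + p), hp0]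
    · nlinarith [sq_nonneg (y 0 + y 1), sq_nonneg (y 1 - y 0 + p), hp0]
    · nlinarith [sq_nonneg (2 * y 0 - y 1), sq_nonneg (y 1 - p), hp0]

/-- "⇒": an ellipse nested between the two triangles forces `a² + b² + c² ≤ 2(ab+bc+ca)` (orbit sum
over `R`, then the point `y* = (t, t/2)` on the `G`-circle through `x₀`). The positive definiteness
of the ellipse is not even needed. [cite: FawziEtAl2015, Ex. 2.7 (p05)] -/
theorem FawziEtAl2015_ex27_of_ellipse {a b c : ℝ} (ha : 0 ≤ a) (hb : 0 ≤ b) (hc : 0 ≤ c)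
    {A : Matrix (Fin 2) (Fin 2) ℝ} {cc : Fin 2 → ℝ} {γ : ℝ}
    (hP : ∀ i, ex27Vertex a b c i ⬝ᵥ (A *ᵥ ex27Vertex a b c i) + 2 * (cc ⬝ᵥ ex27Vertex a b c i) + γ ≤ 0)
    (hQ : ∀ y : Fin 2 → ℝ, y ⬝ᵥ (A *ᵥ y) + 2 * (cc ⬝ᵥ y) + γ ≤ 0 →
      ∀ j, ex27Normal j ⬝ᵥ y ≤ (a + b + c) / 3) :
    a ^ 2 + b ^ 2 + c ^ 2 ≤ 2 * (a * b + b * c + a * c) := by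
  set p : ℝ := (a + b + c) / 3 with hp
  have hp0 : 0 ≤ p := by rw [hp]; positivity
  set q : (Fin 2 → ℝ) → ℝ := fun y => y ⬝ᵥ (A *ᵥ y) + 2 * (cc ⬝ᵥ y) + γ with hq
  -- `G(x₀)` and the point `y*`
  set g : ℝ := 2 * (p - a) ^ 2 - 2 * (p - a) * (c - p) + 2 * (c - p) ^ 2 with hg
  have hg0 : 0 ≤ g := by nlinarith [sq_nonneg (p - a), sq_nonneg (c - p), sq_nonneg (p - a - (c - p))]
  set t : ℝ := Real.sqrt (2 * g / 3) with ht
  have ht0 : 0 ≤ t := Real.sqrt_nonneg _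
  have ht2 : t ^ 2 = 2 * g / 3 := by rw [ht, Real.sq_sqrt (by positivity)]
  -- the orbit of `x₀` is `{x₀, x₁, x₂}`; the orbit sums of `x₀` and of `y* = (t, t/2)` coincide
  have hx1 : (![-(ex27Vertex a b c 0) 1, ex27Vertex a b c 0 0 - ex27Vertex a b c 0 1] : Fin 2 → ℝ) =
      ex27Vertex a b c 1 := by
    ext i
    fin_cases i
    · simp [ex27Vertex]
    · simp [ex27Vertex]; ring
  have hx2 : (![ex27Vertex a b c 0 1 - ex27Vertex a b c 0 0, -(ex27Vertex a b c 0) 0] : Fin 2 → ℝ) =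
      ex27Vertex a b c 2 := by
    ext i
    fin_cases i
    · simp [ex27Vertex]; ring
    · simp [ex27Vertex]
  have hsumx : q (ex27Vertex a b c 0) + q (ex27Vertex a b c 1) + q (ex27Vertex a b c 2) =
      (A 0 0 + (A 0 1 + A 1 0) / 2 + A 1 1) * g + 3 * γ := by
    have h := sum_quad_orbit A cc γ (ex27Vertex a b c 0)
    rw [hx1, hx2] at h
    simp only [hq]
    rw [h]
    simp [ex27Vertex, hg, hp]
  set ys : Fin 2 → ℝ := ![t, t / 2] with hys
  have hsumy : q ys + q ![-ys 1, ys 0 - ys 1] + q ![ys 1 - ys 0, -ys 0] =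
      (A 0 0 + (A 0 1 + A 1 0) / 2 + A 1 1) * g + 3 * γ := by
    have h := sum_quad_orbit A cc γ ys
    simp only [hq]
    rw [h]
    have : 2 * ys 0 ^ 2 - 2 * ys 0 * ys 1 + 2 * ys 1 ^ 2 = g := by
      simp [hys]
      nlinarith [ht2]
    rw [this]
  have hneg : q ys + q ![-ys 1, ys 0 - ys 1] + q ![ys 1 - ys 0, -ys 0] ≤ 0 := by
    rw [hsumy, ← hsumx]
    have := hP 0; have := hP 1; have := hP 2
    simp only [hq] at *
    linarith
  -- so one point of the orbit of `y*` lies in the ellipse, hence in `Q`; its matching facet gives `t ≤ p`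
  have htp : t ≤ p := by
    by_cases h1 : q ys ≤ 0
    · have := hQ ys h1 0
      simpa [ex27Normal, hys, dotProduct, Fin.sum_univ_two] using this
    by_cases h2 : q ![-ys 1, ys 0 - ys 1] ≤ 0
    · have := hQ _ h2 1
      simp [ex27Normal, hys, dotProduct, Fin.sum_univ_two] at this
      linarith
    · have h3 : q ![ys 1 - ys 0, -ys 0] ≤ 0 := by
        have h1' := not_le.mp h1
        have h2' := not_le.mp h2
        linarith
      have := hQ _ h3 2
      simp [ex27Normal, hys, dotProduct, Fin.sum_univ_two] at this
      linarith
  -- `t ≤ p` means `G(x₀) ≤ 3p²/2`, which is the inequality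
  have ht2p : t ^ 2 ≤ p ^ 2 := pow_le_pow_left₀ ht0 htp 2
  rw [ht2] at ht2p
  have key : 3 / 2 * p ^ 2 - g = (2 * (a * b + b * c + a * c) - (a ^ 2 + b ^ 2 + c ^ 2)) / 2 := by
    rw [hg, hp]; ring
  nlinarith [key, ht2p]

/-- **FGPRT Example 2.7** (p05): for nonnegative `a, b, c`,
`rank_psd M(a,b,c) ≤ 2 ⟺ a² + b² + c² ≤ 2(ab + bc + ac)` (printed under the standing assumption
`rank M(a,b,c) = 3`; when `a = b = c` both sides hold trivially, so the equivalence is stated for all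
nonnegative `a, b, c`). Proof: the geometric interpretation (`circulant3_eq_pairSlackMatrix`) and the
§4 ellipse criterion `FawziEtAl2015_sec4_ellipse_holds`, with `FawziEtAl2015_ex27_ellipse` ("⇐") and
`FawziEtAl2015_ex27_of_ellipse` ("⇒"). [cite: FawziEtAl2015, Ex. 2.7 (p05)] -/
theorem FawziEtAl2015_ex27 {a b c : ℝ} (ha : 0 ≤ a) (hb : 0 ≤ b) (hc : 0 ≤ c) :
    HasPsdFactorization (circulant3 a b c) 2 ↔ a ^ 2 + b ^ 2 + c ^ 2 ≤ 2 * (a * b + b * c + a * c) := by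
  by_cases heq : a = b ∧ b = c
  · -- `M(a,a,a)`: both sides hold
    obtain ⟨rfl, rfl⟩ := heq
    refine ⟨fun _ => by nlinarith [sq_nonneg a], fun _ => ?_⟩
    refine HasPsdFactorization.of_nonnegFactorization (fun _ _ => a) (fun _ _ => 1 / 2)
      (fun _ _ => ha) (fun _ _ => by norm_num) fun i j => ?_
    fin_cases i <;> fin_cases j <;> simp [circulant3] <;> ring
  · have hr := rank_circulant3_eq_three ha hb hc heq
    have hslack := circulant3_eq_pairSlackMatrix a b c
    have hr' : (Matrix.of (pairSlackMatrix (ex27Vertex a b c) ex27Normal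
        (fun _ => (a + b + c) / 3))).rank = 3 := by
      rw [← hslack]; exact hr
    have hiff := FawziEtAl2015_sec4_ellipse_holds 3 3 (ex27Vertex a b c) ex27Normal
      (fun _ => (a + b + c) / 3) (fun i j => ex27Vertex_mem ha hb hc i j) (isBounded_ex27Q _) hr'
    rw [hslack, hiff]
    constructor
    · rintro ⟨A, cc, γ, -, hP, hQ⟩
      exact FawziEtAl2015_ex27_of_ellipse ha hb hc hP hQ
    · exact FawziEtAl2015_ex27_ellipse ha hb hc

end Literature.Combinatorics.Optimization
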